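import Literature.NumberTheory.EllipticCurves.JetchevSkinnerWan2017.SigmaImprimitiveCharIdeal
import Literature.NumberTheory.EllipticCurves.BigGaloisRepLocalInputs
import Literature.NumberTheory.GaloisRepresentations.LocalGaloisGroupFrobeniusProofs
import Literature.NumberTheory.GaloisRepresentations.LocalGaloisGroupProofs
import Literature.NumberTheory.DiophantineGeometry.Conductor
import Literature.NumberTheory.EllipticCurves.LocalH1TateDualityLangTateProofs
import Literature.NumberTheory.EllipticCurves.ModularityVersionApProofs
import Literature.NumberTheory.EllipticCurves.AnticyclotomicPrimeDecompositionSplitProofs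
import Literature.NumberTheory.EllipticCurves.ZpExtensionPadicUnitsProofs
import Literature.NumberTheory.GaloisRepresentations.LocalFrobeniusDensity
import HarnessLib

/-!
# The `Σ`-Euler DATA of an elliptic curve: the reduction datum `t_w` and Frobenius exponent
# `c_w = κ(φ_w)` at a finite place, the erratum's set `Σ = {w ∣ N, w ∤ p}` and its `Σ`-Euler element
# `P_Σ(E/K) = ∏_{w ∈ Σ} P_w ∈ Λ = ℤ_p⟦T⟧` — CONCRETE CHOICE TERMS, bound to the curve (no named fact)

Cell `bsd-stepL` (crux `stmt-BirchSwinnertonDyer-19270`, Road FF; typer lane `bsd-stepL-defn-ty1`, session g2).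
The file `SigmaEulerFactors` (p487650) defines the Euler factors `eulerFactor p 𝒪 Nw t c` from LOCAL DATA taken as
parameters, and `JetchevSkinnerWan2017/SigmaImprimitiveCharIdeal` (p488360) binds such data to a curve by the
PREDICATE `IsEulerDataAt W κ w Nw t c`. This file supplies the data as DEFINITIONS and proves the binding:

* §1 `WeierstrassCurve.localReductionDataAt W w : LocalReductionData` — good (with `a_w = W.frobeniusTraceAt w`)
  ∕ split multiplicative ∕ non-split multiplicative ∕ additive, read off the tree's reduction predicates at `w`
  (`LocalReduction`, local trichotomy); `#Ẽ_w(k_w) = N(w) − a_w + 1 ≥ 1` (the reduction has the point `O` and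
  finitely many points), whence every Euler factor of a curve is `≠ 0`.
* §2 `ZpExtension.frobExponentAt κ w : ℤ_p` — `c_w = κ(φ_w)` for a CHOSEN arithmetic Frobenius `φ_w ∈ Γ_{K_w}`
  (the tree's discharged `exists_isFrobPow_holds`) pushed into `Γ_K` along `BigGaloisRep.localMap K (Sum.inl w)`;
  for `w ∤ p` the value does not depend on the choice (`κ` kills `I_w`: `ZpExtension.apply_localMap_inr`,
  `IsFrobPow.mul_inv_mem_absInertia_holds`).
* §3 `isEulerDataAt_localReductionDataAt` — `(N(w), t_w, c_w)` IS Euler data of `W/K` at `w` for `κ`, at EVERY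
  finite place (the predicate of p488360, all three clauses proved).
* §4 for `E/ℚ` (Weierstrass model `W`, conductor `N = W.conductorNorm ℤ`), a prime `p` and a number field `K`:
  `W.sigmaPlaces p K = {w : N ∈ w, p ∉ w}` — the places of `K` dividing `N` and not above `p`; for `p ∥ N` these
  are the places dividing the erratum's tame level `M = N/p` ("`Σ` a finite set of primes `v ∤ p` of `K`
  containing the primes dividing `M`", proof of Thm. 1.1) — finite (`sigmaPlaces_finite`, `sigmaPlacesFinset`),
  away from `p` by construction, containing every `w` above a prime `ℓ ≠ p` dividing `N`
  (`mem_sigmaPlaces_of_prime_mem`, `mem_sigmaPlaces_of_tameLevel_mem`); and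
  **`W.sigmaEulerElement p K κ = P_Σ(E/K) ∈ Λ`** = `sigmaEulerFactor` of the data of §§1–2 over
  `W.sigmaPlacesFinset p K` — non-zero (`sigmaEulerElement_ne_zero`, the glue's `hP`).
* §5 `sigmaData_of_prop332` — the `Σ`-DATA PACKAGE of the Road FF coefficient-free cut (the body of the Summits
  shape `P2.RoadFF.SigmaDataAt W p κ v γ Σ P_Σ` at `Σ := ↑(W.sigmaPlacesFinset p K)`,
  `P_Σ := W.sigmaEulerElement p K κ`, on the Literature twin `Castella2018.AcSelmer.XAc`): `Σ` finite,
  `X^Σ_ac` `Λ`-torsion, `P_Σ ≠ 0`, `Ch_Λ(X^∅_ac)·(P_Σ) ≤ Ch_Λ(X^Σ_ac)` — PROVED from the one published fact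
  `JetchevSkinnerWan2017.prop332_charIdeal_XAc_sigma_change` (F7) under that fact's binders.

These are the CONCRETE CHOICE TERMS `Σ(W, p)(K) := ↑(W.sigmaPlacesFinset p K)` and
`P_Σ(W, p)(K, κ, γ) := W.sigmaEulerElement p K κ` asked for by the cell (planner g30 RULING 1 (C); imc-p1 g8's
coefficient-free cut `P2.RoadFF.{SigmaData,FittingCongruenceFrame}AtErratumData W p Sg PSg`, which is `∀ Sg PSg`).
Definitions with bodies and proved theorems only: no named fact, no `sorry`, no instance, no notation.
* §6 (appended) `mem_sigmaPlaces_of_not_hasGoodReductionAt` — every place of BAD reduction of `W.baseChange K`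
  not above `p` lies in `Σ` (good reduction ascends in `K/ℚ`, `hasGoodReductionAt_baseChange_of_hasGoodReductionAt`;
  bad primes divide the conductor, `dvd_conductorNorm_iff`), i.e. `W_K` has good reduction outside `Σ ∪ {w ∣ p}`
  (`hasGoodReductionAt_baseChange_of_not_mem_sigmaPlaces`) — the reduction-theoretic half of Lemma 2.1's
  "`Σ` contains all primes `v ∤ p` where `T` is ramified"; the Néron–Ogg–Shafarevich half (ramified ⇒ bad) is
  the consumer's, not restated here.
* §7 (appended 2026-08-27, after the CORRECTION of F7 — `prop332_charIdeal_XAc_sigma_change` is false on the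
  Tamagawa-defect locus and is superseded by `prop332_charIdeal_XAc_sigma_change_of_noTamagawaDefect`, see that
  file's module docstring): `ZpExtension.decomp_le_kerSubgroup_of_frobExponentAt_eq_zero` (`c_w = 0` at `w ∤ p`
  ⟹ `D_w ≤ ker κ`, i.e. `w` totally split in `K_∞`: `κ ∘ res` kills `I_w` and a Frobenius, hence — by the
  density of `⟨φ_w⟩ I_w` in `Γ_{K_w}`, `exists_forall_smul_eq_pow_and_mem`, read through the open layers
  `κ⁻¹(p^n ℤ_p)` — all of `Γ_{K_w}`), whence `ZpExtension.frobExponentAt_ne_zero_of_degree_one` (`c_w ≠ 0` at a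
  degree-one `w ∤ p` for `K` imaginary quadratic and `κ` anticyclotomic: Brink 2007 Thm. 2, the tree's PROVED
  `decomp_not_le_kerSubgroup_of_isAnticyclotomic_holds`); `sigmaData_of_prop332_of_noTamagawaDefect` (§5's
  package from the corrected fact under the no-defect binder on `Σ`) and
  `sigmaData_of_prop332_of_splitMult_imp_degree_one` (the binder discharged, for `p > 3`, down to "every split
  multiplicative place of `E/K` in `Σ` has degree one over `ℚ`" — which the Road-FF data satisfy: `IsErratumField`
  splits every `ℓ ∣ N`, `ℓ ≠ q`, and `E/K_{w_q}` is non-split multiplicative; that last step is Summits-side).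
  §5's `sigmaData_of_prop332` is kept (referenced) but binds the SUPERSEDED fact — use §7.

## Sources

* [Castella2018Erratum] F. Castella, *Erratum to "On the `p`-part of the Birch–Swinnerton-Dyer formula for
  multiplicative primes"*, proof of Thm. 1.1 (p. 4): "Put `M = N` if `p ∤ N`, and `M = N/p` if `p ∥ N`. … it
  suffices to prove the result for `X^Σ_ac(E[p^∞])` and `L^Σ_p(f)` for `Σ` a finite set of primes `v ∤ p` of `K`
  containing the primes dividing `M`"; Lemma 2.1 (p. 2): "Suppose `Σ` contains all primes `v ∤ p` where `T_g` is
  ramified".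
* [JetchevSkinnerWan2017] D. Jetchev, C. Skinner, X. Wan, Camb. J. Math. 5 (2017) §5.1: "`L^Σ_p(f) = L_p(f) ×
  ∏_{w∈Σ} P_w(ε⁻¹Ψ⁻¹(Frob_w))`" and the Remark on inert places; proof of Thm. 6.1.6 (the `Σ`-change identity).
* [Skinner2016PacificMC] C. Skinner, Pacific J. Math. 283 (2016) §2.3 p. 180 (the Euler-factor convention adopted
  by `SigmaEulerFactors`, see that file's module docstring).
* [SilvermanAEC2009] J. Silverman, AEC, VII.5 Prop. 5.1 (reduction types), C.§16 (`a_v = q_v + 1 − #Ẽ_v(k_v)`,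
  the local factors at good ∕ split ∕ non-split ∕ additive places).
* [Washington1997] L. Washington, *Introduction to Cyclotomic Fields*, Prop. 13.2 (`ℤ_p`-extensions are
  unramified outside `p`); [TateCorvallis1979] §1.4 (Frobenius elements, Weil group).
* [Brink2007] D. Brink, Math. Comp. 76 (2007), Thm. 2 (split primes are finitely decomposed in the anticyclotomic
  `ℤ_p`-extension); [SerreLocalFields1979] Ch. IV §4 Cor. 2 (`Gal(K_nr/K) = Ẑ`, density of Frobenius powers);
  [Castella2018] Thm. 2.3 (2.7), Prop. 2.5 (the Tamagawa defect at non-split places).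
-/

noncomputable section

open scoped Classical
open WeierstrassCurve NumberField IsDedekindDomain Field Literature.NumberTheory.EllipticCurves
  Literature.NumberTheory.EllipticCurves.Rank1Residual
  Literature.NumberTheory.EllipticCurves.Castella2018
  Literature.NumberTheory.EllipticCurves.IwasawaCharacter
  Literature.NumberTheory.EllipticCurves.BigGaloisRep
  Literature.NumberTheory.EllipticCurves.JetchevSkinnerWan2017
  Literature.NumberTheory.GaloisRepresentations

universe u

/-! ### §1. The reduction datum of a curve at a finite place, and `#Ẽ_w(k_w) ≥ 1` -/

namespace WeierstrassCurve

variable {K : Type u} [Field K] [NumberField K] (W : WeierstrassCurve K) (w : HeightOneSpectrum (𝓞 K))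

/-- **The local reduction datum `t_w` of `W/K` at the finite place `w`** that its `Σ`-Euler factor sees
(`IwasawaCharacter.LocalReductionData`): `good a_w` with `a_w = W.frobeniusTraceAt w = q_w + 1 − #Ẽ_w(k_w)` if `W`
has good reduction at `w`, `splitMult` ∕ `nonsplitMult` if it has split ∕ non-split multiplicative reduction OVER
`K_w`, `additive` otherwise — read off the tree's reduction predicates of `LocalReduction` (local trichotomy,
Silverman VII.5.1). (Deliberate dot-notation extension of Mathlib's `WeierstrassCurve` namespace, as the tree's
`frobeniusTraceAt`.) [cite: SilvermanAEC2009, VII.5 Prop. 5.1 and C.§16] -/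
def localReductionDataAt : LocalReductionData :=
  if W.HasGoodReductionAt w then .good (W.frobeniusTraceAt w)
  else if W.HasSplitMultiplicativeReductionAt w then .splitMult
  else if W.HasMultiplicativeReductionAt w then .nonsplitMult
  else .additive

/-- At a place of good reduction the datum is `good a_w`. [cite: SilvermanAEC2009, VII.5 Prop. 5.1 and C.§16] -/
theorem localReductionDataAt_of_hasGoodReductionAt (h : W.HasGoodReductionAt w) :
    W.localReductionDataAt w = .good (W.frobeniusTraceAt w) := by
  simp [localReductionDataAt, h]

/-- At a place of split multiplicative reduction the datum is `splitMult`.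
[cite: SilvermanAEC2009, VII.5 Prop. 5.1 and C.§16] -/
theorem localReductionDataAt_of_hasSplitMultiplicativeReductionAt (h : W.HasSplitMultiplicativeReductionAt w) :
    W.localReductionDataAt w = .splitMult := by
  have hg : ¬ W.HasGoodReductionAt w := h.hasMultiplicativeReductionAt.not_hasGoodReductionAt
  simp [localReductionDataAt, hg, h]

/-- At a place of non-split multiplicative reduction the datum is `nonsplitMult`.
[cite: SilvermanAEC2009, VII.5 Prop. 5.1 and C.§16] -/
theorem localReductionDataAt_of_not_hasSplitMultiplicativeReductionAt (h : W.HasMultiplicativeReductionAt w)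
    (hns : ¬ W.HasSplitMultiplicativeReductionAt w) : W.localReductionDataAt w = .nonsplitMult := by
  simp [localReductionDataAt, h.not_hasGoodReductionAt, hns, h]

/-- At a place of additive reduction the datum is `additive`. [cite: SilvermanAEC2009, VII.5 Prop. 5.1 and C.§16] -/
theorem localReductionDataAt_of_hasAdditiveReductionAt (h : W.HasAdditiveReductionAt w) :
    W.localReductionDataAt w = .additive := by
  have hg : ¬ W.HasGoodReductionAt w := h.not_hasGoodReductionAt
  have hm : ¬ W.HasMultiplicativeReductionAt w := h.not_hasMultiplicativeReductionAt
  have hs : ¬ W.HasSplitMultiplicativeReductionAt w := fun hs => hm hs.hasMultiplicativeReductionAt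
  simp [localReductionDataAt, hg, hm, hs]

/-- **The datum matches the reduction type** — literally the third clause of `IsEulerDataAt` (local trichotomy:
good ∕ multiplicative ∕ additive, and split vs. non-split by excluded middle).
[cite: SilvermanAEC2009, VII.5 Prop. 5.1 and C.§16] -/
theorem localReductionDataAt_spec :
    (match W.localReductionDataAt w with
      | .good a => W.HasGoodReductionAt w ∧ a = W.frobeniusTraceAt w
      | .splitMult => W.HasSplitMultiplicativeReductionAt w
      | .nonsplitMult => W.HasMultiplicativeReductionAt w ∧ ¬ W.HasSplitMultiplicativeReductionAt w
      | .additive => W.HasAdditiveReductionAt w) := by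
  rcases W.hasGoodReductionAt_or_hasMultiplicativeReductionAt_or_hasAdditiveReductionAt w with hg | hm | ha
  · rw [W.localReductionDataAt_of_hasGoodReductionAt w hg]
    exact ⟨hg, rfl⟩
  · by_cases hs : W.HasSplitMultiplicativeReductionAt w
    · rw [W.localReductionDataAt_of_hasSplitMultiplicativeReductionAt w hs]
      exact hs
    · rw [W.localReductionDataAt_of_not_hasSplitMultiplicativeReductionAt w hm hs]
      exact ⟨hm, hs⟩
  · rw [W.localReductionDataAt_of_hasAdditiveReductionAt w ha]
    exact ha

/-- The residue field `k_w` of the completion at a finite place is finite (its cardinality is `N(w) > 1`,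
`natCard_residueField_eq_residueCard`). [folklore] -/
private theorem finite_residueField_adicCompletionIntegers :
    Finite (IsLocalRing.ResidueField (w.adicCompletionIntegers K)) := by
  refine Nat.finite_of_card_ne_zero ?_
  rw [natCard_residueField_eq_residueCard]
  have := w.one_lt_residueCard
  omega

/-- **The reduction `Ẽ_w` has finitely many `k_w`-points**: `Ẽ_w(k_w)` injects into `Option (k_w × k_w)`
(`O ↦ none`, `(x, y) ↦ some (x, y)`), `k_w` finite. [cite: SilvermanAEC2009, C.§16] -/
theorem finite_point_reductionAt : Finite (W.reductionAt w).toAffine.Point := by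
  haveI := finite_residueField_adicCompletionIntegers w
  refine Finite.of_injective (fun P : (W.reductionAt w).toAffine.Point => match P with
    | .zero => (none : Option (IsLocalRing.ResidueField (w.adicCompletionIntegers K) ×
        IsLocalRing.ResidueField (w.adicCompletionIntegers K)))
    | .some x y _ => some (x, y)) ?_
  intro P Q h
  rcases P with _ | ⟨x, y, hP⟩ <;> rcases Q with _ | ⟨x', y', hQ⟩
  · rfl
  · simp at h
  · simp at h
  · simp only [Option.some.injEq, Prod.mk.injEq] at h
    obtain ⟨rfl, rfl⟩ := h
    rfl

/-- **`N(w) − a_w + 1 = #Ẽ_w(k_w)`** (`a_w = q_w + 1 − #Ẽ_w(k_w)`, `q_w = N(w)`): the value at `T = 0` of the good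
Euler factor `N(w)u² − a_w u + 1` (`constantCoeff_eulerFactor_good`) is the number of points of the reduction.
[cite: SilvermanAEC2009, C.§16] [cite: JetchevSkinnerWan2017, §5.1 (Remark on inert places)] -/
theorem residueCard_sub_frobeniusTraceAt_add_one :
    (w.residueCard : ℤ) - W.frobeniusTraceAt w + 1 = Nat.card (W.reductionAt w).toAffine.Point := by
  rw [frobeniusTraceAt_def, natCard_residueField_eq_residueCard]
  ring

/-- **`N(w) − a_w + 1 ≠ 0`**: the reduction has at least the point `O` and finitely many points, so
`#Ẽ_w(k_w) ≥ 1`. [cite: SilvermanAEC2009, C.§16] -/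
theorem residueCard_sub_frobeniusTraceAt_add_one_ne_zero :
    (w.residueCard : ℤ) - W.frobeniusTraceAt w + 1 ≠ 0 := by
  rw [W.residueCard_sub_frobeniusTraceAt_add_one w]
  haveI := W.finite_point_reductionAt w
  haveI : Nonempty (W.reductionAt w).toAffine.Point := ⟨.zero⟩
  have h : 0 < Nat.card (W.reductionAt w).toAffine.Point := Nat.card_pos
  exact_mod_cast h.ne'

variable {p : ℕ} [Fact p.Prime]

/-- **Every Euler factor of a curve is non-zero in `Λ_𝒪`** (for `𝒪` of characteristic `0`): `N(w) ≠ 1`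
(`one_lt_residueCard`), `#Ẽ_w(k_w) ≠ 0` at a good place, and the multiplicative ∕ additive factors have non-zero
constant term (`eulerFactor_ne_zero_of_charZero`). [cite: JetchevSkinnerWan2017, §5.1 (Remark on inert places)]
[cite: Skinner2016PacificMC, §2.3 (p. 180)] -/
theorem eulerFactor_localReductionDataAt_ne_zero (𝒪 : Type*) [CommRing 𝒪] [Algebra ℤ_[p] 𝒪] [CharZero 𝒪]
    (c : ℤ_[p]) : eulerFactor p 𝒪 (Ideal.absNorm w.asIdeal) (W.localReductionDataAt w) c ≠ 0 := by
  refine eulerFactor_ne_zero_of_charZero p 𝒪 (w.one_lt_residueCard).ne' _ (fun a ha => ?_) c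
  have hs := W.localReductionDataAt_spec w
  rw [ha] at hs
  obtain ⟨-, rfl⟩ := hs
  exact W.residueCard_sub_frobeniusTraceAt_add_one_ne_zero w

end WeierstrassCurve

/-! ### §2. The Frobenius exponent `c_w = κ(φ_w) ∈ ℤ_p` of a `ℤ_p`-extension at a finite place -/

namespace Literature.NumberTheory.EllipticCurves.ZpExtension

variable {K : Type u} [Field K] [NumberField K] {p : ℕ} [Fact p.Prime] (κ : ZpExtension K p)
  (w : HeightOneSpectrum (𝓞 K))

/-- **`c_w = κ(φ_w) ∈ ℤ_p`**, the image under `κ : Γ_K → ℤ_p` of a CHOSEN arithmetic Frobenius `φ_w ∈ Γ_{K_w}`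
(`IsFrobPow φ_w 1`, which exists: `exists_isFrobPow_holds`) restricted to `Γ_K` along the decomposition map
`localMap K (Sum.inl w)`; so `Ψ(φ_w) = (1 + T)^{c_w}` (`IwasawaCharacter.Psi`). For `w ∤ p` it is independent of
the choice (`apply_localMap_inl_eq_frobExponentAt`). [cite: JetchevSkinnerWan2017, §5.1 ("`P_w(ε⁻¹Ψ⁻¹(Frob_w))`")]
[cite: TateCorvallis1979, §1.4 (1.4.1)] -/
def frobExponentAt : ℤ_[p] :=
  (κ (localMap K (Sum.inl w)
    (Classical.choose (exists_isFrobPow_holds (F := w.adicCompletion K) 1)))).toAdd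

/-- The defining property: some arithmetic Frobenius `φ_w` has `κ(φ_w) = c_w` — literally the second clause of
`IsEulerDataAt`. [cite: TateCorvallis1979, §1.4 (1.4.1)] -/
theorem exists_isFrobPow_apply_localMap_eq :
    ∃ φ : absoluteGaloisGroup (w.adicCompletion K),
      IsFrobPow φ 1 ∧ κ (localMap K (Sum.inl w) φ) = Multiplicative.ofAdd (κ.frobExponentAt w) :=
  ⟨_, Classical.choose_spec (exists_isFrobPow_holds (F := w.adicCompletion K) 1),
    (ofAdd_toAdd _).symm⟩

variable {w} in
/-- **For `w ∤ p`, `κ` takes the same value on all arithmetic Frobenii at `w`**: two of them differ by an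
element of `I_w` (`IsFrobPow.mul_inv_mem_absInertia_holds`), on which `κ` is trivial (a `ℤ_p`-extension is
unramified outside `p`, `ZpExtension.apply_localMap_inr`). [cite: Washington1997, Prop. 13.2]
[cite: TateCorvallis1979, §1.4 (1.4.1)] -/
theorem apply_localMap_inl_eq_of_isFrobPow (hw : ((p : ℕ) : 𝓞 K) ∉ w.asIdeal)
    {φ φ' : absoluteGaloisGroup (w.adicCompletion K)} (hφ : IsFrobPow φ 1) (hφ' : IsFrobPow φ' 1) :
    κ (localMap K (Sum.inl w) φ) = κ (localMap K (Sum.inl w) φ') := by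
  have hI : φ * φ'⁻¹ ∈ absInertia (w.adicCompletion K) := IsFrobPow.mul_inv_mem_absInertia_holds hφ hφ'
  have h1 : κ (localMap K (Sum.inr w) ⟨φ * φ'⁻¹, hI⟩) = 1 := κ.apply_localMap_inr hw _
  have h2 : κ (absGaloisRestrict K (w.adicCompletion K) (φ * φ'⁻¹)) = 1 := h1
  rw [map_mul, map_mul, map_inv, map_inv, mul_inv_eq_one] at h2
  exact h2

variable {w} in
/-- **`κ(φ) = c_w` for EVERY arithmetic Frobenius `φ` at a place `w ∤ p`.** [cite: Washington1997, Prop. 13.2]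
[cite: TateCorvallis1979, §1.4 (1.4.1)] -/
theorem apply_localMap_inl_eq_frobExponentAt (hw : ((p : ℕ) : 𝓞 K) ∉ w.asIdeal)
    {φ : absoluteGaloisGroup (w.adicCompletion K)} (hφ : IsFrobPow φ 1) :
    κ (localMap K (Sum.inl w) φ) = Multiplicative.ofAdd (κ.frobExponentAt w) := by
  obtain ⟨φ₀, hφ₀, h⟩ := κ.exists_isFrobPow_apply_localMap_eq w
  rw [κ.apply_localMap_inl_eq_of_isFrobPow hw hφ hφ₀, h]

end Literature.NumberTheory.EllipticCurves.ZpExtension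

/-! ### §3. `(N(w), t_w, c_w)` is Euler data of `W/K` at `w` -/

namespace Literature.NumberTheory.EllipticCurves

variable {K : Type} [Field K] [NumberField K] {p : ℕ} [Fact p.Prime]

/-- **The concrete data `(N(w), W.localReductionDataAt w, κ.frobExponentAt w)` IS the Euler datum of `W/K` at
`w` for `κ`** in the sense of `JetchevSkinnerWan2017.IsEulerDataAt` (all three clauses, at every finite place).
[cite: JetchevSkinnerWan2017, §5.1 (the Euler factors `P_w(ε⁻¹Ψ⁻¹(Frob_w))`)] [cite: Skinner2016PacificMC, §2.3 (p. 180)] -/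
theorem isEulerDataAt_localReductionDataAt (W : WeierstrassCurve K) (κ : ZpExtension K p)
    (w : HeightOneSpectrum (𝓞 K)) :
    IsEulerDataAt W κ w (Ideal.absNorm w.asIdeal) (W.localReductionDataAt w) (κ.frobExponentAt w) :=
  ⟨rfl, κ.exists_isFrobPow_apply_localMap_eq w, W.localReductionDataAt_spec w⟩

end Literature.NumberTheory.EllipticCurves

/-! ### §4. The erratum's `Σ = {w ∣ N, w ∤ p}` and `P_Σ(E/K) ∈ Λ` for `E/ℚ` -/

namespace WeierstrassCurve

variable (W : WeierstrassCurve ℚ) (p : ℕ) (K : Type) [Field K]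

/-- **`Σ(W, p)(K)`: the finite places `w` of `K` DIVIDING THE CONDUCTOR `N = W.conductorNorm ℤ` of `E/ℚ` and NOT
ABOVE `p`** (`N ∈ w`, `p ∉ w`; the clause `N ≠ 0` only excludes the junk conductor of a singular `W` and is
automatic for an elliptic `W`, `mem_sigmaPlaces_iff`). For `p ∥ N` these are exactly the places dividing the
tame level `M = N/p`: the erratum's "`Σ` a finite set of primes `v ∤ p` of `K` containing the primes dividing
`M`", taken minimal. (Deliberate dot-notation extension of Mathlib's `WeierstrassCurve` namespace.)
[cite: Castella2018Erratum, proof of Thm. 1.1 (p. 4, "`M = N/p` if `p ∥ N` … `Σ` … containing the primes dividing `M`")] -/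
def sigmaPlaces : Set (HeightOneSpectrum (𝓞 K)) :=
  {w | W.conductorNorm ℤ ≠ 0 ∧ ((W.conductorNorm ℤ : ℕ) : 𝓞 K) ∈ w.asIdeal ∧ ((p : ℕ) : 𝓞 K) ∉ w.asIdeal}

variable {W p K}

/-- For an elliptic `W` (`N ≥ 1`, `conductorNorm_pos_holds`): `w ∈ Σ ↔ N ∈ w ∧ p ∉ w`.
[cite: Castella2018Erratum, proof of Thm. 1.1 (p. 4)] -/
theorem mem_sigmaPlaces_iff [W.IsElliptic] {w : HeightOneSpectrum (𝓞 K)} :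
    w ∈ W.sigmaPlaces p K ↔
      ((W.conductorNorm ℤ : ℕ) : 𝓞 K) ∈ w.asIdeal ∧ ((p : ℕ) : 𝓞 K) ∉ w.asIdeal := by
  have hN : W.conductorNorm ℤ ≠ 0 := (W.conductorNorm_pos_holds).ne'
  simp [sigmaPlaces, hN]

/-- **`Σ` is away from `p`**: `w ∈ Σ ⇒ p ∉ w` (the binder `∀ w ∈ Σ, p ∉ w` of F7 and of the Euler factors).
[cite: Castella2018Erratum, proof of Thm. 1.1 (p. 4, "primes `v ∤ p` of `K`")] -/
theorem not_mem_of_mem_sigmaPlaces {w : HeightOneSpectrum (𝓞 K)} (hw : w ∈ W.sigmaPlaces p K) :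
    ((p : ℕ) : 𝓞 K) ∉ w.asIdeal :=
  hw.2.2

/-- `w ∈ Σ ⇒ N ∈ w` (`w` divides the conductor). [cite: Castella2018Erratum, proof of Thm. 1.1 (p. 4)] -/
theorem natCast_conductorNorm_mem_of_mem_sigmaPlaces {w : HeightOneSpectrum (𝓞 K)}
    (hw : w ∈ W.sigmaPlaces p K) : ((W.conductorNorm ℤ : ℕ) : 𝓞 K) ∈ w.asIdeal :=
  hw.2.1

/-- Two distinct rational primes are comaximal in `𝓞 K`: if `ℓ ∈ w` and `q ∈ w` for coprime naturals `ℓ, q`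
then `w = ⊤` — so a prime `w ∋ ℓ` does not contain `q`. [folklore] -/
private theorem natCast_not_mem_of_coprime_of_mem {ℓ q : ℕ} (h : Nat.Coprime ℓ q) {w : HeightOneSpectrum (𝓞 K)}
    (hℓ : ((ℓ : ℕ) : 𝓞 K) ∈ w.asIdeal) : ((q : ℕ) : 𝓞 K) ∉ w.asIdeal := by
  intro hq
  have hcop : IsCoprime ((ℓ : ℕ) : 𝓞 K) ((q : ℕ) : 𝓞 K) := by
    have := (Nat.isCoprime_iff_coprime.2 h).map (Int.castRingHom (𝓞 K))
    simpa using this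
  obtain ⟨a, b, hab⟩ := hcop
  refine w.isPrime.ne_top ((Ideal.eq_top_iff_one _).2 ?_)
  rw [← hab]
  exact Ideal.add_mem _ (Ideal.mul_mem_left _ _ hℓ) (Ideal.mul_mem_left _ _ hq)

/-- **Every place above a prime `ℓ ≠ p` dividing `N` lies in `Σ`.** [cite: Castella2018Erratum, proof of Thm. 1.1 (p. 4, "`Σ` … containing the primes dividing `M`")] -/
theorem mem_sigmaPlaces_of_prime_mem [W.IsElliptic] [Fact p.Prime] {ℓ : ℕ} (hℓ : ℓ.Prime)
    (hℓN : ℓ ∣ W.conductorNorm ℤ) (hℓp : ℓ ≠ p) {w : HeightOneSpectrum (𝓞 K)}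
    (hw : ((ℓ : ℕ) : 𝓞 K) ∈ w.asIdeal) : w ∈ W.sigmaPlaces p K := by
  rw [mem_sigmaPlaces_iff]
  refine ⟨?_, natCast_not_mem_of_coprime_of_mem ((Nat.coprime_primes hℓ (Fact.out : p.Prime)).2 hℓp) hw⟩
  obtain ⟨m, hm⟩ := hℓN
  rw [hm, Nat.cast_mul]
  exact Ideal.mul_mem_right _ _ hw

/-- **For `p ∥ N`, every place dividing the tame level `M = N/p` lies in `Σ`** (`N = p·M ∈ w`; `p ∉ w` since
`p ∤ M` makes `p, M` coprime). [cite: Castella2018Erratum, proof of Thm. 1.1 (p. 4, "`M = N/p` if `p ∥ N`")] -/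
theorem mem_sigmaPlaces_of_tameLevel_mem [W.IsElliptic] [Fact p.Prime] (hpN : p ∣ W.conductorNorm ℤ)
    (hpM : ¬ p ∣ W.conductorNorm ℤ / p) {w : HeightOneSpectrum (𝓞 K)}
    (hw : ((W.conductorNorm ℤ / p : ℕ) : 𝓞 K) ∈ w.asIdeal) : w ∈ W.sigmaPlaces p K := by
  rw [mem_sigmaPlaces_iff]
  refine ⟨?_, natCast_not_mem_of_coprime_of_mem
    (Nat.Coprime.symm (((Fact.out : p.Prime)).coprime_iff_not_dvd.2 hpM)) hw⟩
  rw [← Nat.mul_div_cancel' hpN, Nat.cast_mul]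
  exact Ideal.mul_mem_left _ _ hw

variable (W p K) [NumberField K]

/-- `Σ` is finite (finitely many primes of `𝓞 K` divide the non-zero ideal `(N)`, Mathlib `Ideal.finite_factors`).
[cite: Castella2018Erratum, proof of Thm. 1.1 (p. 4, "`Σ` a finite set of primes")] -/
theorem sigmaPlaces_finite : (W.sigmaPlaces p K).Finite := by
  by_cases hN : W.conductorNorm ℤ = 0
  · have h0 : W.sigmaPlaces p K = ∅ := by
      ext w
      simp [sigmaPlaces, hN]
    rw [h0]
    exact Set.finite_empty
  · refine (Ideal.finite_factors (I := Ideal.span {((W.conductorNorm ℤ : ℕ) : 𝓞 K)}) ?_).subset ?_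
    · rw [Ne, Ideal.zero_eq_bot, Ideal.span_singleton_eq_bot]
      exact_mod_cast hN
    · intro w hw
      exact (Ideal.dvd_span_singleton).2 hw.2.1

/-- `Σ` as a `Finset` (the index set of `sigmaEulerFactor`). [cite: Castella2018Erratum, proof of Thm. 1.1 (p. 4)] -/
def sigmaPlacesFinset : Finset (HeightOneSpectrum (𝓞 K)) :=
  (W.sigmaPlaces_finite p K).toFinset

/-- `↑(W.sigmaPlacesFinset p K) = W.sigmaPlaces p K`. [cite: Castella2018Erratum, proof of Thm. 1.1 (p. 4)] -/
@[simp] theorem coe_sigmaPlacesFinset :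
    (↑(W.sigmaPlacesFinset p K) : Set (HeightOneSpectrum (𝓞 K))) = W.sigmaPlaces p K :=
  Set.Finite.coe_toFinset _

variable {W p K} in
/-- Membership in the `Finset` is membership in `Σ`. [cite: Castella2018Erratum, proof of Thm. 1.1 (p. 4)] -/
theorem mem_sigmaPlacesFinset_iff {w : HeightOneSpectrum (𝓞 K)} :
    w ∈ W.sigmaPlacesFinset p K ↔ w ∈ W.sigmaPlaces p K :=
  Set.Finite.mem_toFinset _

/-- The binder `hSp` of F7's corollaries: `∀ w ∈ Σ, p ∉ w`. [cite: Castella2018Erratum, proof of Thm. 1.1 (p. 4)] -/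
theorem forall_mem_sigmaPlacesFinset_not_mem :
    ∀ w ∈ W.sigmaPlacesFinset p K, ((p : ℕ) : 𝓞 K) ∉ w.asIdeal :=
  fun _ hw => not_mem_of_mem_sigmaPlaces (mem_sigmaPlacesFinset_iff.1 hw)

variable [Fact p.Prime]

/-- **`P_Σ(E/K) ∈ Λ = ℤ_p⟦T⟧`, the `Σ`-Euler element of `E/ℚ` over `K` for the `ℤ_p`-extension `κ`**:
`∏_{w ∈ Σ} P_w` with `P_w = eulerFactor p ℤ_p N(w) t_w c_w` (Skinner's convention, file `SigmaEulerFactors`) at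
the CONCRETE data `t_w = (W.baseChange K).localReductionDataAt w`, `c_w = κ.frobExponentAt w` of §§1–2 over
`Σ = W.sigmaPlacesFinset p K`. (Deliberate dot-notation extension of Mathlib's `WeierstrassCurve` namespace.)
[cite: JetchevSkinnerWan2017, §5.1 ("`∏_{w∈Σ} P_w(ε⁻¹Ψ⁻¹(Frob_w))`")] [cite: Castella2018, (3.1)] -/
def sigmaEulerElement (κ : ZpExtension K p) : IwasawaAlgebra p :=
  sigmaEulerFactor p ℤ_[p] (W.sigmaPlacesFinset p K) (fun w => Ideal.absNorm w.asIdeal)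
    (fun w => (W.baseChange K).localReductionDataAt w) (fun w => κ.frobExponentAt w)

/-- Unfolding `sigmaEulerElement`. [cite: JetchevSkinnerWan2017, §5.1] -/
theorem sigmaEulerElement_def (κ : ZpExtension K p) :
    W.sigmaEulerElement p K κ =
      sigmaEulerFactor p ℤ_[p] (W.sigmaPlacesFinset p K) (fun w => Ideal.absNorm w.asIdeal)
        (fun w => (W.baseChange K).localReductionDataAt w) (fun w => κ.frobExponentAt w) :=
  rfl

/-- **`P_Σ(E/K) ≠ 0`** (the glue's `hP`): every factor is non-zero (`eulerFactor_localReductionDataAt_ne_zero`) in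
the domain `Λ`. [cite: JetchevSkinnerWan2017, §5.1 (Remark on inert places)] [cite: Skinner2016PacificMC, §2.3 (p. 180)] -/
theorem sigmaEulerElement_ne_zero (κ : ZpExtension K p) : W.sigmaEulerElement p K κ ≠ 0 :=
  sigmaEulerFactor_ne_zero p ℤ_[p] _ _ _ _ fun w _ =>
    (W.baseChange K).eulerFactor_localReductionDataAt_ne_zero w ℤ_[p] _

/-- **On `Σ` the concrete data are Euler data of `W/K`** (the binder `hdata` of F7's corollaries).
[cite: JetchevSkinnerWan2017, §5.1] -/
theorem isEulerDataAt_of_mem_sigmaPlacesFinset (κ : ZpExtension K p) :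
    ∀ w ∈ W.sigmaPlacesFinset p K, IsEulerDataAt (W.baseChange K) κ w (Ideal.absNorm w.asIdeal)
      ((W.baseChange K).localReductionDataAt w) (κ.frobExponentAt w) :=
  fun w _ => isEulerDataAt_localReductionDataAt (W.baseChange K) κ w

end WeierstrassCurve

/-! ### §5. The `Σ`-data package of the Road FF coefficient-free cut, from F7 -/

namespace Literature.NumberTheory.EllipticCurves.JetchevSkinnerWan2017

/-- **THE `Σ`-DATA PACKAGE AT THE CONCRETE CHOICE TERMS** — for `Σ := ↑(W.sigmaPlacesFinset p K)` and
`P_Σ := W.sigmaEulerElement p K κ`: `Σ` finite ∧ `X^Σ_ac(E/K)` is `Λ`-torsion ∧ `P_Σ ≠ 0` ∧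
`Ch_Λ(X^∅_ac)·(P_Σ) ≤ Ch_Λ(X^Σ_ac)` (the body of the Summits shape `P2.RoadFF.SigmaDataAt W p κ v γ Σ P_Σ` on the
definitionally equal Literature object `Castella2018.AcSelmer.XAc`), PROVED from the published fact
`prop332_charIdeal_XAc_sigma_change` (JSW17 Prop. 3.3.2 + proof of Thm. 6.1.6 + Thm. 3.3.1) under its binders, via
`isTorsion_XAc_sigma`, `charIdeal_XAc_empty_mul_le` and §4. Conditional on that one fact; no other input.
[cite: JetchevSkinnerWan2017, Prop. 3.3.2 with the proof of Thm. 6.1.6 and Thm. 3.3.1]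
[cite: Castella2018Erratum, proof of Thm. 1.1 (p. 4)] -/
theorem sigmaData_of_prop332 (h : prop332_charIdeal_XAc_sigma_change)
    (W : WeierstrassCurve ℚ) [W.IsElliptic] [W.IsGloballyMinimal] (p : ℕ) [Fact p.Prime] (hp : 3 ≤ p)
    (hred : Good W p ∨ Mult W p) (K : Type) [Field K] [NumberField K] (hK : IsImaginaryQuadratic K)
    (hsplit : SatisfiesHeegnerHypothesis p K) (hirr : (W.baseChange K).HasIrreducibleModPGaloisRep p)
    (ι : K →+* ℚ_[p]) (v : HeightOneSpectrum (𝓞 K)) (hv : ∀ x : 𝓞 K, x ∈ v.asIdeal ↔ ‖ι (x : K)‖ < 1)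
    (κ : ZpExtension K p) (hκ : κ.IsAnticyclotomic) (γ : absoluteGaloisGroup K) [Fact (κ.IsTopGenerator γ)]
    (hrk : (W.baseChange K).mordellWeilRank = 1)
    (hsha : Finite (AddCommGroup.primaryComponent (W.baseChange K).sha p)) :
    (↑(W.sigmaPlacesFinset p K) : Set (HeightOneSpectrum (𝓞 K))).Finite ∧
    Module.IsTorsion (IwasawaAlgebra p)
      (AcSelmer.XAc (W.baseChange K) p κ v (↑(W.sigmaPlacesFinset p K)) γ) ∧
    W.sigmaEulerElement p K κ ≠ 0 ∧
    AcSelmer.XAc.charIdeal (W.baseChange K) p κ v ∅ γ * Ideal.span {W.sigmaEulerElement p K κ} ≤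
      AcSelmer.XAc.charIdeal (W.baseChange K) p κ v (↑(W.sigmaPlacesFinset p K)) γ :=
  ⟨Finset.finite_toSet _,
    isTorsion_XAc_sigma W p hp hred K hK hsplit hirr ι v hv κ hκ γ hrk hsha (W.sigmaPlacesFinset p K)
      (W.forall_mem_sigmaPlacesFinset_not_mem p K) _ _ _ (W.isEulerDataAt_of_mem_sigmaPlacesFinset p K κ) h,
    W.sigmaEulerElement_ne_zero p K κ,
    charIdeal_XAc_empty_mul_le W p hp hred K hK hsplit hirr ι v hv κ hκ γ hrk hsha (W.sigmaPlacesFinset p K)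
      (W.forall_mem_sigmaPlacesFinset_not_mem p K) _ _ _ (W.isEulerDataAt_of_mem_sigmaPlacesFinset p K κ) h⟩

end Literature.NumberTheory.EllipticCurves.JetchevSkinnerWan2017

/-! ### §6. The bad places of `E/K` away from `p` lie in `Σ` -/

namespace WeierstrassCurve

variable (W : WeierstrassCurve ℚ) (p : ℕ) {K : Type} [Field K] [NumberField K]

/-- The rational prime `ℓ_u = primesEquiv u` under a finite place `u` of `ℚ` lies in `u`
(Mathlib `Rat.HeightOneSpectrum.natGenerator_dvd_iff`). [folklore] -/
private theorem natCast_primesEquiv_mem (u : HeightOneSpectrum (𝓞 ℚ)) :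
    (((Rat.HeightOneSpectrum.primesEquiv u : Nat.Primes) : ℕ) : 𝓞 ℚ) ∈ u.asIdeal := by
  have h := (Rat.HeightOneSpectrum.natGenerator_dvd_iff u).mp dvd_rfl
  rwa [← map_natCast (Rat.IsIntegralClosure.intEquiv (𝓞 ℚ)), Ideal.apply_mem_of_equiv_iff] at h

variable {W p} in
/-- **Every place of bad reduction of `E/K` not above `p` lies in `Σ`**: if `W_K` has bad reduction at
`w ∤ p`, then `W/ℚ` has bad reduction at the place `u` of `ℚ` under `w` (good reduction ascends in
finite extensions, `hasGoodReductionAt_baseChange_of_hasGoodReductionAt`, Silverman VII.5.4(a)), so the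
prime `ℓ` of `u` divides the conductor `N` (`dvd_conductorNorm_iff`, Silverman ATAEC IV.10.2(a)), `ℓ ≠ p`,
and `w ∋ ℓ` is in `Σ` (`mem_sigmaPlaces_of_prime_mem`). This is the erratum's "`Σ` contains all primes
`v ∤ p` where `T` is ramified" for `T = T_pE` once combined with Néron–Ogg–Shafarevich (ramified ⇒ bad),
which is NOT restated here. [cite: Castella2018Erratum, Lemma 2.1 (p. 2, "Suppose `Σ` contains all primes `v ∤ p` where `T_g` is ramified")]
[cite: SilvermanAEC2009, VII.5 Prop. 5.4(a) and C.§16] -/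
theorem mem_sigmaPlaces_of_not_hasGoodReductionAt [W.IsElliptic] [Fact p.Prime]
    {w : HeightOneSpectrum (𝓞 K)} (hbad : ¬ (W.baseChange K).HasGoodReductionAt w)
    (hwp : ((p : ℕ) : 𝓞 K) ∉ w.asIdeal) : w ∈ W.sigmaPlaces p K := by
  set u : HeightOneSpectrum (𝓞 ℚ) := w.under (𝓞 ℚ) with hu
  haveI : w.asIdeal.LiesOver u.asIdeal := ⟨HeightOneSpectrum.under_asIdeal (𝓞 ℚ) w⟩
  have hbadQ : ¬ W.HasGoodReductionAt u := fun hg =>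
    hbad (hasGoodReductionAt_baseChange_of_hasGoodReductionAt W K u w hg)
  have hℓN : ((Rat.HeightOneSpectrum.primesEquiv u : Nat.Primes) : ℕ) ∣ W.conductorNorm ℤ :=
    (W.dvd_conductorNorm_iff u).2 hbadQ
  have hℓw : (((Rat.HeightOneSpectrum.primesEquiv u : Nat.Primes) : ℕ) : 𝓞 K) ∈ w.asIdeal := by
    have h := natCast_primesEquiv_mem u
    rw [HeightOneSpectrum.under_asIdeal, Ideal.under_def, Ideal.mem_comap, map_natCast] at h
    exact h
  have hℓp : ((Rat.HeightOneSpectrum.primesEquiv u : Nat.Primes) : ℕ) ≠ p := fun h =>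
    hwp (h ▸ hℓw)
  exact mem_sigmaPlaces_of_prime_mem (Rat.HeightOneSpectrum.primesEquiv u).2 hℓN hℓp hℓw

variable {W p} in
/-- **Outside `Σ ∪ {w ∣ p}` the base change `E/K` has good reduction** (contrapositive of
`mem_sigmaPlaces_of_not_hasGoodReductionAt`): the form in which the erratum's Lemma 2.1 uses `Σ`
(the classes are unramified outside `S = Σ ∪ S_p`). [cite: Castella2018Erratum, Lemma 2.1 and its proof (p. 2, "`S = Σ ∪ S_p`")]
[cite: SilvermanAEC2009, VII.5 Prop. 5.4(a) and C.§16] -/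
theorem hasGoodReductionAt_baseChange_of_not_mem_sigmaPlaces [W.IsElliptic] [Fact p.Prime]
    {w : HeightOneSpectrum (𝓞 K)} (hw : w ∉ W.sigmaPlaces p K) (hwp : ((p : ℕ) : 𝓞 K) ∉ w.asIdeal) :
    (W.baseChange K).HasGoodReductionAt w := by
  by_contra hbad
  exact hw (mem_sigmaPlaces_of_not_hasGoodReductionAt hbad hwp)

end WeierstrassCurve

/-! ### §7. No Tamagawa defect on `Σ`: totally split places, Brink, and the package from the corrected F7 -/

namespace Literature.NumberTheory.EllipticCurves.ZpExtension

variable {K : Type} [Field K] [NumberField K] {p : ℕ} [Fact p.Prime] (κ : ZpExtension K p)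

/-- **A place `w ∤ p` with `c_w = κ(φ_w) = 0` is totally split in `K_∞`: `D_w ≤ ker κ`.** The character
`κ ∘ res_w : Γ_{K_w} → ℤ_p` kills the inertia group (`κ` is unramified outside `p`, `apply_localMap_inr`) and an
arithmetic Frobenius `φ_w` (`c_w = 0`); since `⟨φ_w⟩ · I_w` is dense in `Γ_{K_w}` (`exists_forall_smul_eq_pow_and_mem`,
applied to the open preimages of the layers `κ⁻¹(p^n ℤ_p)`), `κ(res_w σ) ∈ ⋂_n p^n ℤ_p = 0` for every `σ`.
[cite: SerreLocalFields1979, Ch. IV §4 Cor. 2 to Prop. 16 (`Gal(K_nr/K) = Ẑ`)] [cite: Washington1997, Prop. 13.2] -/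
theorem decomp_le_kerSubgroup_of_frobExponentAt_eq_zero {w : HeightOneSpectrum (𝓞 K)}
    (hw : ((p : ℕ) : 𝓞 K) ∉ w.asIdeal) (h0 : κ.frobExponentAt w = 0) :
    GreenbergSelmer.decomp w ≤ κ.kerSubgroup := by
  rintro _ ⟨σ, rfl⟩
  rw [ZpExtension.mem_kerSubgroup]
  change κ (absGaloisRestrict K (w.adicCompletion K) σ) = 1
  obtain ⟨φ, hφ, hκφ⟩ := κ.exists_isFrobPow_apply_localMap_eq w
  rw [h0, ofAdd_zero] at hκφ
  have hφa : IsAbsArithFrob φ := isFrobPow_one_iff_isAbsArithFrob_holds.mp hφ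
  set res := absGaloisRestrict K (w.adicCompletion K) with hres
  have hφ1 : κ (res φ) = 1 := hκφ
  have hdvd : ∀ n : ℕ, (p : ℤ_[p]) ^ n ∣ (κ (res σ)).toAdd := by
    intro n
    have hU : IsOpen (res ⁻¹' (κ.layerSubgroup n : Set (absoluteGaloisGroup K))) :=
      (κ.isOpen_layerSubgroup n).preimage res.continuous
    have hIU : (absInertia (w.adicCompletion K) : Set _) ⊆
        res ⁻¹' (κ.layerSubgroup n : Set (absoluteGaloisGroup K)) := by
      intro i hi
      show res i ∈ κ.layerSubgroup n
      have h1 : κ (res i) = 1 := κ.apply_localMap_inr hw ⟨i, hi⟩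
      rw [ZpExtension.mem_layerSubgroup, h1, toAdd_one]
      exact dvd_zero _
    obtain ⟨a, -, ha⟩ :=
      IsNonarchimedeanLocalField.exists_forall_smul_eq_pow_and_mem hφa σ ∅ (by simp) hU hIU
    have ha' : res ((φ ^ a)⁻¹ * σ) ∈ κ.layerSubgroup n := ha
    rw [ZpExtension.mem_layerSubgroup, map_mul, map_inv, map_pow, map_mul, map_inv, map_pow, hφ1,
      one_pow, inv_one, one_mul] at ha'
    exact ha'
  rw [← ofAdd_toAdd (κ (res σ)), PadicUnits.eq_zero_of_forall_pow_dvd hdvd, ofAdd_zero]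

/-- **`c_w = κ(φ_w) ≠ 0` at a degree-one place `w ∤ p` (its rational prime splits in `K`), for `K` imaginary
quadratic and `κ` anticyclotomic** — Brink 2007, Thm. 2 (such `w` is finitely decomposed in `K_∞^ac`; the tree's
PROVED `decomp_not_le_kerSubgroup_of_isAnticyclotomic_holds`) combined with
`decomp_le_kerSubgroup_of_frobExponentAt_eq_zero`. [cite: Brink2007, Thm. 2 (pp. 2134–2135) and Cor. 1] -/
theorem frobExponentAt_ne_zero_of_degree_one (hK : IsImaginaryQuadratic K) (hp : p ≠ 2)
    (hκ : κ.IsAnticyclotomic) {w : HeightOneSpectrum (𝓞 K)} (hw : ((p : ℕ) : 𝓞 K) ∉ w.asIdeal)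
    (he : w.asIdeal.ramificationIdx (𝓞 ℚ) = 1) (hf : w.asIdeal.inertiaDeg (𝓞 ℚ) = 1) :
    κ.frobExponentAt w ≠ 0 := fun h0 =>
  decomp_not_le_kerSubgroup_of_isAnticyclotomic_holds K p hK hp κ hκ w hw he hf
    (κ.decomp_le_kerSubgroup_of_frobExponentAt_eq_zero hw h0)

end Literature.NumberTheory.EllipticCurves.ZpExtension

namespace WeierstrassCurve

variable (W : WeierstrassCurve ℚ) (p : ℕ) [Fact p.Prime] (K : Type) [Field K] [NumberField K]

/-- If the reduction datum at `w` is `splitMult`, the reduction of `E/K` at `w` is split multiplicative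
(`localReductionDataAt_spec`). [cite: SilvermanAEC2009, VII.5 Prop. 5.1] -/
theorem hasSplitMultiplicativeReductionAt_of_localReductionDataAt_eq {K : Type} [Field K] [NumberField K]
    (W : WeierstrassCurve K) (w : HeightOneSpectrum (𝓞 K)) (h : W.localReductionDataAt w = .splitMult) :
    W.HasSplitMultiplicativeReductionAt w := by
  have hs := W.localReductionDataAt_spec w
  rw [h] at hs
  exact hs

/-- **No Tamagawa defect on `Σ(W, p)(K)` when the split multiplicative places of `E/K` in `Σ` lie over
primes split in `K`** (`K` imaginary quadratic, `κ` anticyclotomic, `p > 3`): such places are finitely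
decomposed in `K_∞` (Brink 2007 Thm. 2, the tree's PROVED `decomp_not_le_kerSubgroup_of_isAnticyclotomic_holds`,
through `frobExponentAt_ne_zero_of_degree_one`), so `c_w ≠ 0` there, and `p ≠ 3` disposes of the additive
clause. The residual hypothesis is the Road-FF one: under `IsErratumField W K q` every `ℓ ∣ N` other than
`q` splits in `K`, and `E/K_{w_q}` is NON-split multiplicative.
[cite: Brink2007, Thm. 2] [cite: Castella2018, Prop. 2.5 and its proof] -/
theorem noTamagawaDefect_sigmaPlaces_of_splitMult_imp_degree_one (hK : IsImaginaryQuadratic K)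
    (hp3 : 3 < p) (κ : ZpExtension K p) (hκ : κ.IsAnticyclotomic)
    (hS : ∀ w ∈ W.sigmaPlacesFinset p K, (W.baseChange K).HasSplitMultiplicativeReductionAt w →
      w.asIdeal.ramificationIdx (𝓞 ℚ) = 1 ∧ w.asIdeal.inertiaDeg (𝓞 ℚ) = 1) :
    ∀ w ∈ W.sigmaPlacesFinset p K,
      NoTamagawaDefect p ((W.baseChange K).localReductionDataAt w) (κ.frobExponentAt w) := by
  intro w hw
  refine noTamagawaDefect_of_splitMult_imp (by omega) fun ht => ?_
  have hsm := (W.baseChange K).hasSplitMultiplicativeReductionAt_of_localReductionDataAt_eq w ht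
  obtain ⟨he, hf⟩ := hS w hw hsm
  exact κ.frobExponentAt_ne_zero_of_degree_one hK (by omega) hκ
    (W.forall_mem_sigmaPlacesFinset_not_mem p K w hw) he hf

end WeierstrassCurve

namespace Literature.NumberTheory.EllipticCurves.JetchevSkinnerWan2017

/-- **THE `Σ`-DATA PACKAGE AT THE CONCRETE CHOICE TERMS, FROM THE CORRECTED FACT** — same conclusion as
`sigmaData_of_prop332`, proved from `prop332_charIdeal_XAc_sigma_change_of_noTamagawaDefect` under its
binders and the no-defect binder on `Σ(W, p)(K)` for the concrete data (`localReductionDataAt`,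
`frobExponentAt`). [cite: JetchevSkinnerWan2017, Prop. 3.3.2 with the proof of Thm. 6.1.6 and Thm. 3.3.1]
[cite: Castella2018, Thm. 2.3 (2.7), Prop. 2.5] [cite: Castella2018Erratum, proof of Thm. 1.1 (p. 4)] -/
theorem sigmaData_of_prop332_of_noTamagawaDefect (h : prop332_charIdeal_XAc_sigma_change_of_noTamagawaDefect)
    (W : WeierstrassCurve ℚ) [W.IsElliptic] [W.IsGloballyMinimal] (p : ℕ) [Fact p.Prime] (hp : 3 ≤ p)
    (hred : Good W p ∨ Mult W p) (K : Type) [Field K] [NumberField K] (hK : IsImaginaryQuadratic K)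
    (hsplit : SatisfiesHeegnerHypothesis p K) (hirr : (W.baseChange K).HasIrreducibleModPGaloisRep p)
    (ι : K →+* ℚ_[p]) (v : HeightOneSpectrum (𝓞 K)) (hv : ∀ x : 𝓞 K, x ∈ v.asIdeal ↔ ‖ι (x : K)‖ < 1)
    (κ : ZpExtension K p) (hκ : κ.IsAnticyclotomic) (γ : absoluteGaloisGroup K) [Fact (κ.IsTopGenerator γ)]
    (hrk : (W.baseChange K).mordellWeilRank = 1)
    (hsha : Finite (AddCommGroup.primaryComponent (W.baseChange K).sha p))
    (hB : ∀ w ∈ W.sigmaPlacesFinset p K,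
      NoTamagawaDefect p ((W.baseChange K).localReductionDataAt w) (κ.frobExponentAt w)) :
    (↑(W.sigmaPlacesFinset p K) : Set (HeightOneSpectrum (𝓞 K))).Finite ∧
    Module.IsTorsion (IwasawaAlgebra p)
      (AcSelmer.XAc (W.baseChange K) p κ v (↑(W.sigmaPlacesFinset p K)) γ) ∧
    W.sigmaEulerElement p K κ ≠ 0 ∧
    AcSelmer.XAc.charIdeal (W.baseChange K) p κ v ∅ γ * Ideal.span {W.sigmaEulerElement p K κ} ≤
      AcSelmer.XAc.charIdeal (W.baseChange K) p κ v (↑(W.sigmaPlacesFinset p K)) γ :=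
  ⟨Finset.finite_toSet _,
    isTorsion_XAc_sigma' W p hp hred K hK hsplit hirr ι v hv κ hκ γ hrk hsha (W.sigmaPlacesFinset p K)
      (W.forall_mem_sigmaPlacesFinset_not_mem p K) _ _ _ (W.isEulerDataAt_of_mem_sigmaPlacesFinset p K κ) h,
    W.sigmaEulerElement_ne_zero p K κ,
    charIdeal_XAc_empty_mul_le' W p hp hred K hK hsplit hirr ι v hv κ hκ γ hrk hsha (W.sigmaPlacesFinset p K)
      (W.forall_mem_sigmaPlacesFinset_not_mem p K) _ _ _ (W.isEulerDataAt_of_mem_sigmaPlacesFinset p K κ) h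
      hB⟩

/-- **THE `Σ`-DATA PACKAGE FROM THE CORRECTED FACT, with the no-defect binder DISCHARGED down to the
Road-FF residual** "every split multiplicative place of `E/K` in `Σ(W, p)(K)` has degree one over `ℚ`"
(`p > 3`; Brink 2007 Thm. 2 PROVED in the tree). At an erratum datum (`IsErratumField W K q`: all `ℓ ∣ N`,
`ℓ ≠ q` split in `K`; `E/ℚ_q` non-split multiplicative, `K_{w_q}/ℚ_q` ramified so `E/K_{w_q}` stays non-split)
the residual holds — to be discharged Summits-side in that vocabulary.
[cite: JetchevSkinnerWan2017, Prop. 3.3.2 with the proof of Thm. 6.1.6 and Thm. 3.3.1]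
[cite: Castella2018, Thm. 2.3 (2.7), Prop. 2.5] [cite: Brink2007, Thm. 2] [cite: Castella2018Erratum, proof of Thm. 1.1 (p. 4)] -/
theorem sigmaData_of_prop332_of_splitMult_imp_degree_one
    (h : prop332_charIdeal_XAc_sigma_change_of_noTamagawaDefect)
    (W : WeierstrassCurve ℚ) [W.IsElliptic] [W.IsGloballyMinimal] (p : ℕ) [Fact p.Prime] (hp3 : 3 < p)
    (hred : Good W p ∨ Mult W p) (K : Type) [Field K] [NumberField K] (hK : IsImaginaryQuadratic K)
    (hsplit : SatisfiesHeegnerHypothesis p K) (hirr : (W.baseChange K).HasIrreducibleModPGaloisRep p)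
    (ι : K →+* ℚ_[p]) (v : HeightOneSpectrum (𝓞 K)) (hv : ∀ x : 𝓞 K, x ∈ v.asIdeal ↔ ‖ι (x : K)‖ < 1)
    (κ : ZpExtension K p) (hκ : κ.IsAnticyclotomic) (γ : absoluteGaloisGroup K) [Fact (κ.IsTopGenerator γ)]
    (hrk : (W.baseChange K).mordellWeilRank = 1)
    (hsha : Finite (AddCommGroup.primaryComponent (W.baseChange K).sha p))
    (hS : ∀ w ∈ W.sigmaPlacesFinset p K, (W.baseChange K).HasSplitMultiplicativeReductionAt w →
      w.asIdeal.ramificationIdx (𝓞 ℚ) = 1 ∧ w.asIdeal.inertiaDeg (𝓞 ℚ) = 1) :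
    (↑(W.sigmaPlacesFinset p K) : Set (HeightOneSpectrum (𝓞 K))).Finite ∧
    Module.IsTorsion (IwasawaAlgebra p)
      (AcSelmer.XAc (W.baseChange K) p κ v (↑(W.sigmaPlacesFinset p K)) γ) ∧
    W.sigmaEulerElement p K κ ≠ 0 ∧
    AcSelmer.XAc.charIdeal (W.baseChange K) p κ v ∅ γ * Ideal.span {W.sigmaEulerElement p K κ} ≤
      AcSelmer.XAc.charIdeal (W.baseChange K) p κ v (↑(W.sigmaPlacesFinset p K)) γ :=
  sigmaData_of_prop332_of_noTamagawaDefect h W p hp3.le hred K hK hsplit hirr ι v hv κ hκ γ hrk hsha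
    (W.noTamagawaDefect_sigmaPlaces_of_splitMult_imp_degree_one p K hK hp3 κ hκ hS)

end Literature.NumberTheory.EllipticCurves.JetchevSkinnerWan2017

end
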